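import Mathlib
import HarnessLib
import Summits.Ventures.LatticeQCDFlow.Scaling.HellingerLength
import Summits.Ventures.LatticeQCDFlow.Scaling.PerfectRelaxationVolume

/-!
# LatticeQCDFlow / Scaling — the VOLUME × LAYER-COUNT LAW `ÊSS ≤ exp(−m·‖√p_n − √p_0‖²/n)` (v2.5)

HONEST FRAMING: exact (Metropolis-corrected) sampling algorithms for lattice gauge theory; figures
of merit are autocorrelation/cost numbers at stated couplings and volumes; no continuum-physics
claim.

Venture `LatticeQCDFlow` (cell pub-lqcd), topic `Scaling`, FANOUT row 29 (theory2) — OUR WORK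
(THEORY-2.md v2.5 §3.5 (v)–(vi) / §4 row C3).  Finite-state, elementary; nothing cited as a fact.

Two corollaries joining the LAYER-COUNT LAW (`HellingerLength`:
`Π_k ESS(p_{k+1}, p_k) ≤ exp(−‖√p_n − √p_0‖²/n)`) to the domination theorems:

* `monotoneLayers_ess_le_exp_neg_hellinger` — (C3″) `perfectRelaxation_dominates_monotone'`:
  an annealing sampler (NE-MCMC / stochastic normalizing flow) whose layers preserve their targets
  and are MONOTONE for the order induced by the observable `A` driving the protocol has
  `ÊSS ≤ exp(−‖√p_n − √p_0‖²/n)`: at least `‖√p_n − √p_0‖²/log(1/ÊSS)` layers.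
* `perfectRelaxation_volume_length_law` (+ `_imh`) — (C3-VOL) `perfectRelaxation_volume_law`:
  for `m` independent sites with sitewise monotone layers, `ÊSS ≤ exp(−m·‖√p_n − √p_0‖²_site/n)`;
  i.e. **the number of layers must grow at least LINEARLY IN THE VOLUME `m`**,
  `n ≥ m·‖√p_n − √p_0‖²_site / log(1/ÊSS)`, with an `O(1)` single-site Hellinger constant — the
  printed `ÊSS ≈ exp(−k′·n_dof/n_step)` behaviour (arXiv:2510.25704 §3.1) as a one-sided THEOREM
  for this class of samplers (no smoothness, no asymptotics).  Not a bound over all stationary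
  kernels: the exact `Fin 4` witness `flowMCMC_layer_can_beat_perfectRelaxation`
  (`PerfectRelaxationIMHCounterexample`) and (C3′)'s refutation show non-monotone layers can beat
  perfect relaxation.
-/

noncomputable section

namespace Summit.Ventures.LatticeQCDFlow.Theory2

open Finset Literature.Probability.MarkovChains Summit.Ventures.LatticeQCDFlow.Exactness

section Monotone

variable {X : Type*} [Fintype X] [Nonempty X] [DecidableEq X] {n : ℕ}

/-- **(C3″) + layer-count law.**  Target-preserving layers that are monotone for the order
induced by `A` (increments `S_{k+1} − S_k` non-decreasing in `A`) give
`ÊSS ≤ exp(−‖√p_n − √p_0‖²/n)`, `p_k = e^{−S_k}/Z_k`. [folklore] -/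
theorem monotoneLayers_ess_le_exp_neg_hellinger (hn : 0 < n) (A : X → ℝ)
    (S : Fin (n + 1) → X → ℝ) (P : Fin n → X → X → ℝ)
    (hinc : ∀ (k : Fin n) (x y : X), A x ≤ A y →
      S k.succ x - S k.castSucc x ≤ S k.succ y - S k.castSucc y)
    (hP0 : ∀ k x y, 0 ≤ P k x y)
    (hst : ∀ k : Fin n, IsStationary (fun x => Real.exp (-(S k.succ x))) (P k))
    (hmono : ∀ (k : Fin n) (f : X → ℝ), (∀ x y, A x ≤ A y → f y ≤ f x) →
      ∀ x y, A x ≤ A y → ∑ z, P k y z * f z ≤ ∑ z, P k x z * f z) :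
    essFrac (revPathLaw S P) (pathLaw (gibbsLaw (S 0)) P) ≤
      Real.exp (-(‖sqrtVec (gibbsLaw (S (Fin.last n))) - sqrtVec (gibbsLaw (S 0))‖ ^ 2 / n)) :=
  (perfectRelaxation_dominates_monotone' A S P hinc hP0 hst hmono).trans
    (prod_essFrac_le_exp_neg_hellinger hn (fun k => gibbsLaw (S k)) (fun _ x => gibbsLaw_pos _ x)
      fun _ => sum_gibbsLaw _)

end Monotone

section Volume

variable {Z : Type*} [LinearOrder Z] [Fintype Z] [Nonempty Z] {n : ℕ}

omit [LinearOrder Z] in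
/-- From the single-site layer-count law to the `m`-th power. [folklore] -/
theorem prod_essFrac_pow_le_exp (hn : 0 < n) (m : ℕ) (A : Z → ℝ) (β : Fin (n + 1) → ℝ) :
    (∏ k : Fin n, essFrac (gibbsLaw fun z => β k.succ * A z)
        (gibbsLaw fun z => β k.castSucc * A z)) ^ m ≤
      Real.exp (-((m : ℝ) * ‖sqrtVec (gibbsLaw fun z => β (Fin.last n) * A z) -
        sqrtVec (gibbsLaw fun z => β 0 * A z)‖ ^ 2 / n)) := by
  have h := prod_essFrac_le_exp_neg_hellinger hn (fun k => gibbsLaw fun z => β k * A z)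
    (fun _ z => gibbsLaw_pos _ z) fun _ => sum_gibbsLaw _
  calc (∏ k : Fin n, essFrac (gibbsLaw fun z => β k.succ * A z)
          (gibbsLaw fun z => β k.castSucc * A z)) ^ m
      ≤ Real.exp (-(‖sqrtVec (gibbsLaw fun z => β (Fin.last n) * A z) -
          sqrtVec (gibbsLaw fun z => β 0 * A z)‖ ^ 2 / n)) ^ m :=
        pow_le_pow_left₀ (prod_nonneg fun k _ => essFrac_nonneg fun z => (gibbsLaw_pos _ z).le) h m
    _ = _ := by
        rw [← Real.exp_nat_mul]
        congr 1
        ring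

/-- **THE VOLUME × LAYER-COUNT LAW (proved).**  `m` independent sites, single-site Gibbs laws
`∝ e^{−β_k A}` with `A` and `β` monotone, sitewise target-preserving monotone layers:
`ÊSS ≤ exp(−m·‖√p_n − √p_0‖²_site / n)` — the number of layers needed for a fixed ÊSS grows at
least linearly in the volume. [folklore] -/
theorem perfectRelaxation_volume_length_law (hn : 0 < n) (m : ℕ) (A : Z → ℝ) (hA : Monotone A)
    (β : Fin (n + 1) → ℝ) (hβ : Monotone β) (K : Fin n → Z → Z → ℝ)
    (hK0 : ∀ k a b, 0 ≤ K k a b)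
    (hKst : ∀ k : Fin n,
      Literature.Probability.MarkovChains.IsStationary (fun z => Real.exp (-(β k.succ * A z)))
        (K k))
    (hKmono : ∀ (k : Fin n) (g : Z → ℝ), Antitone g → Antitone fun a => ∑ b, K k a b * g b) :
    essFrac (revPathLaw (siteSum m A β) fun k => blockKernel fun _ : Fin m => K k)
        (pathLaw (gibbsLaw (siteSum m A β 0)) fun k => blockKernel fun _ : Fin m => K k) ≤
      Real.exp (-((m : ℝ) * ‖sqrtVec (gibbsLaw fun z => β (Fin.last n) * A z) -
        sqrtVec (gibbsLaw fun z => β 0 * A z)‖ ^ 2 / n)) :=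
  (perfectRelaxation_volume_law m A hA β hβ K hK0 hKst hKmono).trans
    (prod_essFrac_pow_le_exp hn m A β)

/-- **The volume × layer-count law for sitewise independence-Metropolis (flow-proposal) layers**
(from `perfectRelaxation_volume_law_imh`). [folklore] -/
theorem perfectRelaxation_volume_length_law_imh (hn : 0 < n) (m : ℕ) (A : Z → ℝ)
    (hA : StrictMono A) (β : Fin (n + 1) → ℝ) (hβ : Monotone β) (γ : Fin n → ℝ) :
    essFrac
        (revPathLaw (siteSum m A β) fun k => blockKernel fun _ : Fin m =>
          imhKernel (fun z => Real.exp (-(β k.succ * A z))) (gibbsLaw fun z => γ k * A z))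
        (pathLaw (gibbsLaw (siteSum m A β 0)) fun k => blockKernel fun _ : Fin m =>
          imhKernel (fun z => Real.exp (-(β k.succ * A z))) (gibbsLaw fun z => γ k * A z)) ≤
      Real.exp (-((m : ℝ) * ‖sqrtVec (gibbsLaw fun z => β (Fin.last n) * A z) -
        sqrtVec (gibbsLaw fun z => β 0 * A z)‖ ^ 2 / n)) :=
  (perfectRelaxation_volume_law_imh m A hA β hβ γ).trans (prod_essFrac_pow_le_exp hn m A β)

end Volume

end Summit.Ventures.LatticeQCDFlow.Theory2

end
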